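import Literature.MathematicalPhysics.QuantumLattice.GrassmannDeterminantBounded
import Literature.MathematicalPhysics.QuantumLattice.GrassmannIntegrationByParts
import HarnessLib

/-!
# Explicit lines out of a Gram-bounded Gaussian expectation: the Wick rule `e` times, the Gram bound on the rest

Topic `Literature/MathematicalPhysics/QuantumLattice`; companion of `GrassmannDeterminantBounded` (the hypothesis `IsGramBounded C κ`:
`‖∫ dμ_C ψ(Z₁)⋯ψ(Z_N)‖ ≤ κ^N` for every string) and `GrassmannIntegrationByParts` (the Wick rule `gaussExpect_gen_mul`:
`∫ dμ_C ψ(X)·a = Σ_Y A_C(X,Y) ∫ dμ_C ∂_Y a`).  In the sector analysis of a renormalisation-group step the Gram bound alone is LEVEL-BLIND: it forgets which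
leg pairs with which, hence the sector diagonality of the lines.  Feldman–Knörrer–Trubowitz's «overlapping loops» device extracts a few lines
EXPLICITLY (their two-point functions then pin the sectors of the partner legs) and Gram-bounds the rest — at polynomial, not factorial, cost.
PROVED here, for a string `ψ(Za₀)⋯ψ(Za_{e−1})·ψ(W₀)⋯ψ(W_{n−1})` whose first `e` legs do not pair among themselves (`A_C(Za_i, Za_j) = 0`, e.g. legs
of one vertex / one replica under an inter-replica covariance):

* `sum_contr_smul_grassmannDeriv_genProd_eq_zero` — the pairing operator `Σ_Y A_C(X,Y) ∂_Y` of a leg `X` that pairs with no leg of `A` kills `ψ(A)`;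
* `sum_contr_smul_grassmannDeriv_genProd` — on `ψ(W)` it deletes one leg: `Σ_Y A_C(X,Y) ∂_Y ψ(W) = Σ_l (−1)^l A_C(X, W_l) ψ(W ∖ l)`;
* **`norm_gaussExpect_genProd_mul_genProd_le_of_isGramBounded`** — for `IsGramBounded C κ`, `κ ≥ 0`, `e ≤ n`:
  `‖∫ dμ_C ψ(Za)·ψ(W)‖ ≤ (∏_{i<e} Σ_{l<n} ‖A_C(Za_i, W_l)‖) · κ^{n−e}` — each explicit leg `Za_i` paired with SOME `W_l` through the explicit two-point
  function, the other `n − e` legs of `W` at the Gram price `κ` each; the number of pairings is absorbed by the sums (no `e!`, no `n!`);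
* `isGramBounded_gramWeighted` — Gram weights of norm `≤ 1` keep the constant (tensor weights);
  **`norm_gaussExpect_scriptCov_genProd_mul_genProd_le_of_isGramBounded`** — the same extraction for the interpolated covariance `C_{s,t}` of a valid
  script (the Gaussian factor of the tree formula), explicit factors `A_C` (the interpolation weights `⟨u, u'⟩ ≤ 1` only help).

Generic (`𝕜 = ℝ, ℂ`, finite `Γ`); no definitions, no named facts.

## Sources

J. Feldman, H. Knörrer, E. Trubowitz, Commun. Math. Phys. 247 (2004) 195–242, App. B (Gram bounds) (`FeldmanKnorrerTrubowitz2004`); Rev. Math. Phys. 15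
(2003) 1121–1169, §VI (overlapping loops) (`FeldmanKnorrerTrubowitz2003b`); G. Benfatto, A. Giuliani, V. Mastropietro, Ann. Henri Poincaré 7 (2006)
(2.79)–(2.80) (`BenfattoGiulianiMastropietro2006`).
-/

noncomputable section

namespace Literature.MathematicalPhysics.QuantumLattice

open GrassmannAlgebra Matrix Finset

section LineExtraction

variable {𝕜 : Type*} [RCLike 𝕜] {Γ : Type*} [Fintype Γ] [DecidableEq Γ]

/-- **The pairing operator of a leg that pairs with no leg of `A` kills `ψ(A)`**: if `A_C(X, A_k) = 0` for all `k`, then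
`Σ_Y A_C(X,Y) • ∂_Y ψ(A₀)⋯ψ(A_{m−1}) = 0` (Salmhofer 1999, (4.86): a derivative deletes one field, with the
two-point function as coefficient). [cite: Salmhofer1999, §4.3.1 (4.86)] -/
theorem sum_contr_smul_grassmannDeriv_genProd_eq_zero (C : Matrix Γ Γ 𝕜) (X : Γ) :
    ∀ {m : ℕ} (A : Fin m → Γ), (∀ k, contr 𝕜 C X (A k) = 0) →
      ∑ Y, contr 𝕜 C X Y • grassmannDeriv 𝕜 Y (genProd 𝕜 A) = 0
  | 0, A, _ => by simp [genProd_zero, grassmannDeriv_one]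
  | m + 1, A, hA => by
    simp_rw [grassmannDeriv_genProd, smul_sum, smul_ite, smul_zero]
    rw [sum_comm]
    refine sum_eq_zero fun k _ => ?_
    rw [sum_ite_eq' univ (A k), if_pos (mem_univ _), hA k, zero_smul]

/-- **The pairing operator deletes one leg of `ψ(W)`**: `Σ_Y A_C(X,Y) • ∂_Y ψ(W₀)⋯ψ(W_n) = Σ_l ((−1)^l A_C(X, W_l)) • ψ(W ∘ l.succAbove)`
(Salmhofer 1999, (4.86)). [cite: Salmhofer1999, §4.3.1 (4.86)] -/
theorem sum_contr_smul_grassmannDeriv_genProd (C : Matrix Γ Γ 𝕜) (X : Γ) {n : ℕ} (W : Fin (n + 1) → Γ) :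
    ∑ Y, contr 𝕜 C X Y • grassmannDeriv 𝕜 Y (genProd 𝕜 W) =
      ∑ l : Fin (n + 1), ((-1 : 𝕜) ^ (l : ℕ) * contr 𝕜 C X (W l)) • genProd 𝕜 (W ∘ l.succAbove) := by
  simp_rw [grassmannDeriv_genProd, smul_sum, smul_ite, smul_zero]
  rw [sum_comm]
  refine sum_congr rfl fun l _ => ?_
  rw [sum_ite_eq' univ (W l), if_pos (mem_univ _), smul_smul, mul_comm]

/-- **Explicit lines out of a Gram-bounded Gaussian expectation** (FKT's overlapping-loops device at the level of one Gaussian expectation): if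
`IsGramBounded C κ`, `κ ≥ 0`, the legs `Za` do not pair among themselves and `e ≤ n`, then
`‖∫ dμ_C ψ(Za₀)⋯ψ(Za_{e−1})·ψ(W₀)⋯ψ(W_{n−1})‖ ≤ (∏_{i<e} Σ_{l<n} ‖A_C(Za_i, W_l)‖) · κ^{n−e}`.
[cite: FeldmanKnorrerTrubowitz2004, App. B] -/
theorem norm_gaussExpect_genProd_mul_genProd_le_of_isGramBounded {C : Matrix Γ Γ 𝕜} {κ : ℝ} (hGB : IsGramBounded C κ) (hκ : 0 ≤ κ) :
    ∀ {e : ℕ} (Za : Fin e → Γ) {n : ℕ} (W : Fin n → Γ), (∀ i j, contr 𝕜 C (Za i) (Za j) = 0) → e ≤ n →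
      ‖gaussExpect 𝕜 C (genProd 𝕜 Za * genProd 𝕜 W)‖ ≤ (∏ i, ∑ l, ‖contr 𝕜 C (Za i) (W l)‖) * κ ^ (n - e)
  | 0, Za, n, W, _, _ => by
    rw [genProd_zero, one_mul, univ_eq_empty, prod_empty, one_mul, Nat.sub_zero]
    exact hGB.norm_gaussExpect_genProd_le W
  | e + 1, Za, n, W, hZa, hen => by
    obtain ⟨n', rfl⟩ : ∃ n', n = n' + 1 := ⟨n - 1, by omega⟩
    -- the first explicit leg in front
    set A : Fin e → Γ := Fin.tail Za with hA
    have hA0 : ∀ k, contr 𝕜 C (Za 0) (A k) = 0 := fun k => hZa 0 k.succ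
    have hAA : ∀ i j, contr 𝕜 C (A i) (A j) = 0 := fun i j => hZa i.succ j.succ
    have hsplit : genProd 𝕜 Za * genProd 𝕜 W = gen 𝕜 (Za 0) * (genProd 𝕜 A * genProd 𝕜 W) := by
      rw [genProd_succ, mul_assoc]
    -- the Wick rule, the graded Leibniz rule, and the two deletions
    have hwick : gaussExpect 𝕜 C (genProd 𝕜 Za * genProd 𝕜 W) =
        (-1 : 𝕜) ^ e * ∑ l : Fin (n' + 1), ((-1 : 𝕜) ^ (l : ℕ) * contr 𝕜 C (Za 0) (W l)) *
          gaussExpect 𝕜 C (genProd 𝕜 A * genProd 𝕜 (W ∘ l.succAbove)) := by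
      rw [hsplit, gaussExpect_gen_mul]
      have hterm : ∀ Y, (((1 / 2 : ℚ) • (1 : 𝕜)) * (C Y (Za 0) - C (Za 0) Y)) * gaussExpect 𝕜 C (grassmannDeriv 𝕜 Y (genProd 𝕜 A * genProd 𝕜 W)) =
          gaussExpect 𝕜 C ((contr 𝕜 C (Za 0) Y • grassmannDeriv 𝕜 Y (genProd 𝕜 A)) * genProd 𝕜 W) +
            (-1 : 𝕜) ^ e * gaussExpect 𝕜 C (genProd 𝕜 A * (contr 𝕜 C (Za 0) Y • grassmannDeriv 𝕜 Y (genProd 𝕜 W))) := by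
        intro Y
        rw [← contr_apply, grassmannDeriv_mul, involute_genProd, map_add, mul_add]
        simp only [smul_mul_assoc, mul_smul_comm, map_smul, smul_eq_mul]
        ring
      have h1 : ∑ Y, gaussExpect 𝕜 C ((contr 𝕜 C (Za 0) Y • grassmannDeriv 𝕜 Y (genProd 𝕜 A)) * genProd 𝕜 W) = 0 := by
        rw [← map_sum, ← Finset.sum_mul, sum_contr_smul_grassmannDeriv_genProd_eq_zero C (Za 0) A hA0, zero_mul, map_zero]
      have h2 : ∑ Y, gaussExpect 𝕜 C (genProd 𝕜 A * (contr 𝕜 C (Za 0) Y • grassmannDeriv 𝕜 Y (genProd 𝕜 W))) =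
          ∑ l : Fin (n' + 1), ((-1 : 𝕜) ^ (l : ℕ) * contr 𝕜 C (Za 0) (W l)) *
            gaussExpect 𝕜 C (genProd 𝕜 A * genProd 𝕜 (W ∘ l.succAbove)) := by
        rw [← map_sum, ← Finset.mul_sum, sum_contr_smul_grassmannDeriv_genProd, Finset.mul_sum, map_sum]
        refine sum_congr rfl fun l _ => ?_
        rw [mul_smul_comm, map_smul, smul_eq_mul]
      simp_rw [hterm]
      rw [sum_add_distrib, h1, zero_add, ← Finset.mul_sum, h2]
    -- norms: the induction hypothesis on each deleted string, then monotonicity of the partner sums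
    rw [hwick, norm_mul, norm_pow, norm_neg, norm_one, one_pow, one_mul]
    refine (norm_sum_le _ _).trans ?_
    have hih : ∀ l : Fin (n' + 1), ‖gaussExpect 𝕜 C (genProd 𝕜 A * genProd 𝕜 (W ∘ l.succAbove))‖ ≤
        (∏ i, ∑ l', ‖contr 𝕜 C (A i) (W l')‖) * κ ^ (n' - e) := by
      intro l
      refine (norm_gaussExpect_genProd_mul_genProd_le_of_isGramBounded hGB hκ A (W ∘ l.succAbove) hAA (by omega)).trans ?_
      refine mul_le_mul_of_nonneg_right (prod_le_prod (fun i _ => sum_nonneg fun _ _ => norm_nonneg _) fun i _ => ?_) (pow_nonneg hκ _)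
      rw [Fin.sum_univ_succAbove (fun l' => ‖contr 𝕜 C (A i) (W l')‖) l]
      simp only [Function.comp_apply]
      linarith [norm_nonneg (contr 𝕜 C (A i) (W l))]
    calc ∑ l : Fin (n' + 1), ‖((-1 : 𝕜) ^ (l : ℕ) * contr 𝕜 C (Za 0) (W l)) *
          gaussExpect 𝕜 C (genProd 𝕜 A * genProd 𝕜 (W ∘ l.succAbove))‖
        ≤ ∑ l : Fin (n' + 1), ‖contr 𝕜 C (Za 0) (W l)‖ * ((∏ i, ∑ l', ‖contr 𝕜 C (A i) (W l')‖) * κ ^ (n' - e)) :=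
          sum_le_sum fun l _ => by
            rw [norm_mul, norm_mul, norm_pow, norm_neg, norm_one, one_pow, one_mul]
            exact mul_le_mul_of_nonneg_left (hih l) (norm_nonneg _)
      _ = (∏ i : Fin (e + 1), ∑ l, ‖contr 𝕜 C (Za i) (W l)‖) * κ ^ (n' + 1 - (e + 1)) := by
          rw [← sum_mul, Fin.prod_univ_succ, Nat.add_sub_add_right, mul_assoc]
          rfl

end LineExtraction

/-! ### Gram weights keep Gram-boundedness; explicit lines out of the interpolated covariance of a script -/

section Weighted

variable {𝕜 : Type*} [RCLike 𝕜] {Γ : Type*} [Fintype Γ] [DecidableEq Γ]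

/-- **Gram weights of norm `≤ 1` keep Gram-boundedness with the same constant**: `IsGramBounded C κ → IsGramBounded (gramWeighted U₀ C) κ`
(a further weight family `U` composes with `U₀` into the tensor weights `U X ⊗ U₀ X`, again of norm `≤ 1`; BGM 2006, (2.67)/(2.80)).
[cite: BenfattoGiulianiMastropietro2006, (2.80)] -/
theorem isGramBounded_gramWeighted {C : Matrix Γ Γ 𝕜} {κ : ℝ} (h : IsGramBounded C κ) {n₀ : ℕ} (U₀ : Γ → EuclideanSpace ℝ (Fin n₀))
    (hU₀ : ∀ X, ‖U₀ X‖ ≤ 1) : IsGramBounded (gramWeighted U₀ C) κ := by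
  intro n U hU N Z
  -- tensor weights, re-indexed to `Fin (n * n₀)`
  set e : PiLp 2 (fun _ : Fin n => EuclideanSpace ℝ (Fin n₀)) ≃ₗᵢ[ℝ] EuclideanSpace ℝ (Fin (n * n₀)) :=
    (LinearIsometryEquiv.piLpCurry ℝ 2 (fun (_ : Fin n) (_ : Fin n₀) => ℝ)).symm.trans
      (LinearIsometryEquiv.piLpCongrLeft 2 ℝ ℝ ((Equiv.sigmaEquivProd (Fin n) (Fin n₀)).trans finProdFinEquiv)) with he
  set U' : Γ → EuclideanSpace ℝ (Fin (n * n₀)) := fun X => e (FermionicTree.tens ℝ (U X) (U₀ X)) with hU'def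
  have hU' : ∀ X, ‖U' X‖ ≤ 1 := fun X => by
    rw [hU'def, LinearIsometryEquiv.norm_map, FermionicTree.norm_tens]
    exact (mul_le_mul (hU X) (hU₀ X) (norm_nonneg _) zero_le_one).trans (by rw [one_mul])
  have hcov : gramWeighted U (gramWeighted U₀ C) = gramWeighted U' C := by
    ext X Y
    rw [gramWeighted_apply, gramWeighted_apply, gramWeighted_apply, hU'def, LinearIsometryEquiv.inner_map_map, FermionicTree.inner_tens,
      ← mul_assoc]
    congr 1
    simp only [RCLike.ofReal_real_eq_id, id_eq]
    push_cast
    ring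
  rw [hcov]
  exact h (n * n₀) U' hU' N Z

variable {ι : Type*} [Fintype ι] [DecidableEq ι] {v : ι} {k : ℕ}

omit [Fintype ι] in
open Literature.Probability.LatticeModels Literature.Probability.LatticeModels.BattleFederbush Literature.MeasureTheory.Integral MvPolynomial in
/-- **Explicit lines out of the INTERPOLATED covariance of a valid script** (the Gaussian factor of the Battle–Brydges–Federbush / Gallavotti–Nicolò
tree formula, BGM 2006, (2.66)–(2.67)): for `IsGramBounded C κ`, `κ ≥ 0`, a valid script `s`, `t` in the unit cube, legs `Za` that do not pair among
themselves and `e ≤ n`, `‖∫ dμ_{C_{s,t}} ψ(Za)·ψ(W)‖ ≤ (∏_{i<e} Σ_{l<n} ‖A_C(Za_i, W_l)‖) · κ^{n−e}` — the interpolation weights `⟨u,u'⟩ ≤ 1` only help.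
[cite: BenfattoGiulianiMastropietro2006, (2.80)] -/
theorem norm_gaussExpect_scriptCov_genProd_mul_genProd_le_of_isGramBounded {C : Matrix Γ Γ 𝕜} {κ : ℝ} (hGB : IsGramBounded C κ) (hκ : 0 ≤ κ)
    (cl : Γ → ι) (s : Script v k) (hs : s.Valid) {t : ι → ℝ} (ht : t ∈ unitCube ι)
    {e : ℕ} (Za : Fin e → Γ) {n : ℕ} (W : Fin n → Γ) (hZa : ∀ i j, contr 𝕜 C (Za i) (Za j) = 0) (hen : e ≤ n) :
    ‖gaussExpect 𝕜 (scriptCov C cl s t) (genProd 𝕜 Za * genProd 𝕜 W)‖ ≤ (∏ i, ∑ l, ‖contr 𝕜 C (Za i) (W l)‖) * κ ^ (n - e) := by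
  classical
  obtain ⟨U, hU, hcov⟩ := exists_scriptCov_eq_gramWeighted C cl s hs ht
  rw [hcov]
  have hZa' : ∀ i j, contr 𝕜 (gramWeighted (U ∘ cl) C) (Za i) (Za j) = 0 := fun i j => by
    rw [contr_gramWeighted, hZa i j, mul_zero]
  refine (norm_gaussExpect_genProd_mul_genProd_le_of_isGramBounded (isGramBounded_gramWeighted hGB (U ∘ cl) fun X => hU (cl X)) hκ Za W hZa' hen).trans
    (mul_le_mul_of_nonneg_right (prod_le_prod (fun i _ => sum_nonneg fun _ _ => norm_nonneg _) fun i _ =>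
      sum_le_sum fun l _ => ?_) (pow_nonneg hκ _))
  -- `|⟨U a, U b⟩| ≤ 1`
  rw [contr_gramWeighted, norm_mul]
  refine (mul_le_mul_of_nonneg_right ?_ (norm_nonneg _)).trans (by rw [one_mul])
  rw [RCLike.norm_ofReal, Function.comp_apply, Function.comp_apply]
  exact (abs_real_inner_le_norm _ _).trans ((mul_le_mul (hU _) (hU _) (norm_nonneg _) zero_le_one).trans (by rw [one_mul]))

end Weighted

end Literature.MathematicalPhysics.QuantumLattice

end
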